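import Summits.CriticalPhenomena.CardyFormulaZ2.Theorems.CardyFlipRussoVoronoiHubFromSmirnovTupleCount

/-!
# Stub `poisson_exists_tuple_le_pi` of line `moebius-exact-delaunay-dilation-ward`
# (crux `VoronoiHubFromSmirnov`, stmt-CriticalPhenomena-6433)

The probability form of the defect-count bound of Benjamini–Schramm (I. Benjamini, O. Schramm,
*Conformal invariance of Voronoi percolation*, Comm. Math. Phys. 197 (1998) 75–107, Lemma 5.2):
for a Poisson point process `P` on `ℂ` with σ-finite intensity `ν`, every `m` and every measurable
`S ⊆ ℂ^m`,

`P {c | some injective m-tuple of points of c lies in S} ≤ ν^{⊗m}(S)`.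

Proof (first-moment method). Let `T c = #{x ∈ c^m injective : x ∈ S} ∈ ℝ≥0∞`, written as the
`tsum` over the subtype of injective tuples of points of `c` of the indicator of `S`.
* `T` is measurable for the count σ-algebra (the tree's `exists_measurable_tsum_injective` with the
  s-finite counting kernel `PointConfig.countKernel`, parameter space `Unit`);
* on the event in question `T ≥ 1` (one term of the sum is `1`);
* Markov's inequality gives `P(event) ≤ 𝔼_P T`, and `𝔼_P T = ν^{⊗m}(S)` is the first-moment
  identity `poisson_tupleCount_lintegral_eq` (the multivariate Mecke equation, Last–Penrose 2017
  Thm 4.4, landed in `…TupleCount`).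

No new definitions; tree facts and Mathlib only.
-/

noncomputable section

namespace Summit.CriticalPhenomena.CardyFormulaZ2.Cruxes.VoronoiHubFromSmirnov.MoebiusExactDelaunayDilationWard

open scoped ENNReal
open Set MeasureTheory
open Literature.Analysis.FunctionSpaces

/-- **The number of injective `m`-tuples of points of `c` in a measurable `S` is a measurable
function of the configuration `c`** (count σ-algebra): the tree's measurable version of sums over
injective tuples (`exists_measurable_tsum_injective`, with the s-finite counting kernel
`PointConfig.countKernel` and the trivial parameter space `Unit`) agrees with it everywhere, since
every configuration of `ℂ` is countable. [folklore] -/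
theorem tp_measurable_tupleCount {m : ℕ} {S : Set (Fin m → ℂ)} (hS : MeasurableSet S) :
    Measurable fun c : PointConfig ℂ =>
      ∑' x : {x : Fin m → ℂ // Function.Injective x ∧ ∀ i, x i ∈ c},
        S.indicator (fun _ => (1 : ℝ≥0∞)) x.1 := by
  obtain ⟨Φ, hΦm, hΦ⟩ := IsPoissonPointProcess.exists_measurable_tsum_injective
    (PointConfig.countKernel (E := ℂ)) univ (fun c _ => PointConfig.countKernel_apply c)
    (fun c _ => c.countable_carrier) m (α := Unit)
    (fun p => S.indicator (fun _ => (1 : ℝ≥0∞)) p.2.1)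
    ((measurable_const.indicator hS).comp measurable_snd.fst)
  have heq : (fun c : PointConfig ℂ =>
      ∑' x : {x : Fin m → ℂ // Function.Injective x ∧ ∀ i, x i ∈ c},
        S.indicator (fun _ => (1 : ℝ≥0∞)) x.1) = fun c => Φ ((), c) :=
    funext fun c => (hΦ () c (mem_univ c)).symm
  rw [heq]
  exact hΦm.comp (measurable_const.prodMk measurable_id)

/-- If some injective `m`-tuple of points of `c` lies in `S`, then the number of such tuples is at
least `1` (a single term of a sum in `ℝ≥0∞` is at most the sum). [folklore] -/
theorem tp_one_le_tupleCount {m : ℕ} {S : Set (Fin m → ℂ)} {c : PointConfig ℂ}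
    (h : ∃ x : Fin m → ℂ, Function.Injective x ∧ (∀ i, x i ∈ c) ∧ x ∈ S) :
    (1 : ℝ≥0∞) ≤ ∑' x : {x : Fin m → ℂ // Function.Injective x ∧ ∀ i, x i ∈ c},
        S.indicator (fun _ => (1 : ℝ≥0∞)) x.1 := by
  obtain ⟨x, hinj, hmem, hxS⟩ := h
  calc (1 : ℝ≥0∞) = S.indicator (fun _ => (1 : ℝ≥0∞)) x :=
        (indicator_of_mem hxS fun _ => (1 : ℝ≥0∞)).symm
    _ ≤ ∑' y : {x : Fin m → ℂ // Function.Injective x ∧ ∀ i, x i ∈ c},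
          S.indicator (fun _ => (1 : ℝ≥0∞)) y.1 :=
        ENNReal.le_tsum (f := fun y : {x : Fin m → ℂ // Function.Injective x ∧ ∀ i, x i ∈ c} =>
          S.indicator (fun _ => (1 : ℝ≥0∞)) y.1) ⟨x, hinj, hmem⟩

/-- **Benjamini–Schramm 1998, Lemma 5.2 (probability form).** For a Poisson point process `P` on
`ℂ` with σ-finite intensity `ν`, every `m` and every measurable `S ⊆ ℂ^m`, the probability that
some `m`-tuple of distinct points of the configuration lies in `S` is at most `ν^{⊗m}(S)`:
Markov's inequality for the tuple count, whose expectation is `ν^{⊗m}(S)` by the multivariate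
Mecke equation (`poisson_tupleCount_lintegral_eq`). [cite: LastPenrose2017, Thm 4.4] -/
theorem poisson_exists_tuple_le_pi : ∀ {ν : MeasureTheory.Measure ℂ} [MeasureTheory.SigmaFinite ν] {P : MeasureTheory.Measure (Literature.Analysis.FunctionSpaces.PointConfig ℂ)}, Literature.Analysis.FunctionSpaces.IsPoissonPointProcess ν P → ∀ (m : ℕ) (S : Set (Fin m → ℂ)), MeasurableSet S → P {c | ∃ x : Fin m → ℂ, Function.Injective x ∧ (∀ i, x i ∈ c) ∧ x ∈ S} ≤ (MeasureTheory.Measure.pi fun _ : Fin m => ν) S := by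
  intro ν _ P hP m S hS
  calc P {c | ∃ x : Fin m → ℂ, Function.Injective x ∧ (∀ i, x i ∈ c) ∧ x ∈ S}
      ≤ ∫⁻ c, (∑' x : {x : Fin m → ℂ // Function.Injective x ∧ ∀ i, x i ∈ c},
          S.indicator (fun _ => (1 : ℝ≥0∞)) x.1) ∂P :=
        meas_le_lintegral₀ (tp_measurable_tupleCount hS).aemeasurable
          fun c hc => tp_one_le_tupleCount hc
    _ = (MeasureTheory.Measure.pi fun _ : Fin m => ν) S := poisson_tupleCount_lintegral_eq hP m S hS

end Summit.CriticalPhenomena.CardyFormulaZ2.Cruxes.VoronoiHubFromSmirnov.MoebiusExactDelaunayDilationWard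

end
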